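import Summits.QuantumFields.GaugeBoot.OneOverNMaster
import HarnessLib

/-!
# Operation sums of a loop sequence, component by component (gauge-boot, ADDENDUM 30 part O)

HONEST FRAMING (cell `pub-gaugeboot`, page 1 of every file): the venture produces certified bounds
on lattice expectations at stated coupling, gauge group, dimension and torus size; NOT a mass gap,
NOT a continuum limit, NOT a string tension; NOT Yang–Mills-summit-bearing (barriers
`FixedCouplingUltralocality`, `PerturbativeInvisibility`).  Combinatorics of the loop operations of S. Chatterjee, Comm. Math.
Phys. **366** (2019) §2.2; nothing about four-dimensional continuum Yang–Mills or a mass gap.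

## Content

Bookkeeping for the lane's FIRST-ORDER FACTORIZATION theorem (sibling `OneOverNFirstOrderFactorization`): the splitting,
deformation and twisting sums over a loop sequence `s = (l₁,…,lₙ)` in minimal representation decompose over the components,
the result of an operation on `lᵢ` being `(l₁,…,lᵢ₋₁) ++ prune(pieces) ++ (lᵢ₊₁,…,lₙ)` (`replaceAt_eq_append`,
`sum_posSplitAt_eq` … `sum_posTwistAt_eq`), and for a ONE-loop sequence `(l)` the operation sums are plain sums over the
locations of `l` (`sum_posSplitAt_singleton` … `sum_posTwistAt_singleton`), with the same inner index types — so that the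
master loop equation of `(lᵢ)` can be substituted into the equation of `s`.

Everything is `[folklore]` given the source's definitions.
-/

noncomputable section

open Finset
open Literature.MathematicalPhysics.QuantumLattice (ZdPlaquette)
open Literature.MathematicalPhysics.QuantumFieldTheory.Chatterjee2019LargeN
open Literature.MathematicalPhysics.QuantumFieldTheory.Chatterjee2019LargeN.Word
  (posSplit₁ posSplit₂ negSplit₁ negSplit₂ negTwist posTwist posDeform negDeform)

namespace Summit.QuantumFields.GaugeBoot

namespace StringDuality

variable {d : ℕ}

/-! ## The shape of a replacement -/

/-- For a loop sequence without null components, replacing the `i`-th component by the words `ws` gives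
`(l₁,…,lᵢ₋₁) ++ prune(ws) ++ (lᵢ₊₁,…,lₙ)`. [cite: Chatterjee2019LargeN, §2.2 (operations on loop sequences; minimal representation)] -/
theorem replaceAt_eq_append {s : LoopSeq d} (hs : ∀ l ∈ s, l ≠ []) (i : Fin s.length) (ws : List (List (DEdge d))) :
    s.replaceAt i ws = s.take i ++ LoopSeq.prune ws ++ s.drop (i + 1) := by
  unfold LoopSeq.replaceAt LoopSeq.prune
  rw [List.filter_append, List.filter_append]
  have h1 : (s.take i).filter (fun l => l ≠ []) = s.take i :=
    List.filter_eq_self.mpr fun l hl => by simpa using hs l (List.mem_of_mem_take hl)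
  have h2 : (s.drop (i + 1)).filter (fun l => l ≠ []) = s.drop (i + 1) :=
    List.filter_eq_self.mpr fun l hl => by simpa using hs l (List.mem_of_mem_drop hl)
  rw [h1, h2]

/-! ## Operation sums of `s`, component by component -/

/-- Positive splittings, by component. [cite: Chatterjee2019LargeN, §2.2 (𝕊⁺(s))] -/
theorem sum_posSplitAt_eq {s : LoopSeq d} (hs : ∀ l ∈ s, l ≠ []) (f : LoopSeq d → ℝ) :
    ∑ o : SameIdx s, f (s.posSplitAt o) =
      ∑ i : Fin s.length, ∑ q : {xy : Fin (s.get i).length × Fin (s.get i).length //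
          xy.1 ≠ xy.2 ∧ (s.get i).get xy.2 = (s.get i).get xy.1},
        f (s.take i ++ LoopSeq.prune [posSplit₁ (s.get i) q.1.1 q.1.2, posSplit₂ (s.get i) q.1.1 q.1.2] ++ s.drop (i + 1)) := by
  rw [Fintype.sum_sigma]
  refine Finset.sum_congr rfl fun i _ => Finset.sum_congr rfl fun q _ => ?_
  rw [← replaceAt_eq_append hs]
  rfl

/-- Negative splittings, by component. [cite: Chatterjee2019LargeN, §2.2 (𝕊⁻(s))] -/
theorem sum_negSplitAt_eq {s : LoopSeq d} (hs : ∀ l ∈ s, l ≠ []) (f : LoopSeq d → ℝ) :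
    ∑ o : InvIdx s, f (s.negSplitAt o) =
      ∑ i : Fin s.length, ∑ q : {xy : Fin (s.get i).length × Fin (s.get i).length //
          (s.get i).get xy.2 = DEdge.inv ((s.get i).get xy.1)},
        f (s.take i ++ LoopSeq.prune [negSplit₁ (s.get i) q.1.1 q.1.2, negSplit₂ (s.get i) q.1.1 q.1.2] ++ s.drop (i + 1)) := by
  rw [Fintype.sum_sigma]
  refine Finset.sum_congr rfl fun i _ => Finset.sum_congr rfl fun q _ => ?_
  rw [← replaceAt_eq_append hs]
  rfl

/-- Negative twistings, by component. [cite: Chatterjee2019LargeN, §2.2 (𝕋⁻(s))] -/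
theorem sum_negTwistAt_eq {s : LoopSeq d} (hs : ∀ l ∈ s, l ≠ []) (f : LoopSeq d → ℝ) :
    ∑ o : SameIdx s, f (s.negTwistAt o) =
      ∑ i : Fin s.length, ∑ q : {xy : Fin (s.get i).length × Fin (s.get i).length //
          xy.1 ≠ xy.2 ∧ (s.get i).get xy.2 = (s.get i).get xy.1},
        f (s.take i ++ LoopSeq.prune [negTwist (s.get i) q.1.1 q.1.2] ++ s.drop (i + 1)) := by
  rw [Fintype.sum_sigma]
  refine Finset.sum_congr rfl fun i _ => Finset.sum_congr rfl fun q _ => ?_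
  rw [← replaceAt_eq_append hs]
  rfl

/-- Positive twistings, by component. [cite: Chatterjee2019LargeN, §2.2 (𝕋⁺(s))] -/
theorem sum_posTwistAt_eq {s : LoopSeq d} (hs : ∀ l ∈ s, l ≠ []) (f : LoopSeq d → ℝ) :
    ∑ o : InvIdx s, f (s.posTwistAt o) =
      ∑ i : Fin s.length, ∑ q : {xy : Fin (s.get i).length × Fin (s.get i).length //
          (s.get i).get xy.2 = DEdge.inv ((s.get i).get xy.1)},
        f (s.take i ++ LoopSeq.prune [posTwist (s.get i) q.1.1 q.1.2] ++ s.drop (i + 1)) := by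
  rw [Fintype.sum_sigma]
  refine Finset.sum_congr rfl fun i _ => Finset.sum_congr rfl fun q _ => ?_
  rw [← replaceAt_eq_append hs]
  rfl

/-- Positive deformations, by component. [cite: Chatterjee2019LargeN, §2.2 (𝔻⁺(s))] -/
theorem sum_posDeformAt_eq {s : LoopSeq d} (hs : ∀ l ∈ s, l ≠ []) (f : LoopSeq d → ℝ) :
    ∑ o : DeformIdx s, f (s.posDeformAt o) =
      ∑ i : Fin s.length, ∑ y : (Σ x : Fin (s.get i).length, ↥(plaquettesAt ((s.get i).get x))),
        f (s.take i ++ LoopSeq.prune [posDeform (s.get i) y.1 y.2.1] ++ s.drop (i + 1)) := by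
  rw [Fintype.sum_sigma]
  refine Finset.sum_congr rfl fun i _ => Finset.sum_congr rfl fun y _ => ?_
  rw [← replaceAt_eq_append hs]
  rfl

/-- Negative deformations, by component. [cite: Chatterjee2019LargeN, §2.2 (𝔻⁻(s))] -/
theorem sum_negDeformAt_eq {s : LoopSeq d} (hs : ∀ l ∈ s, l ≠ []) (f : LoopSeq d → ℝ) :
    ∑ o : DeformIdx s, f (s.negDeformAt o) =
      ∑ i : Fin s.length, ∑ y : (Σ x : Fin (s.get i).length, ↥(plaquettesAt ((s.get i).get x))),
        f (s.take i ++ LoopSeq.prune [negDeform (s.get i) y.1 y.2.1] ++ s.drop (i + 1)) := by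
  rw [Fintype.sum_sigma]
  refine Finset.sum_congr rfl fun i _ => Finset.sum_congr rfl fun y _ => ?_
  rw [← replaceAt_eq_append hs]
  rfl

/-! ## Operation sums of a one-loop sequence -/

/-- The only component index of a one-loop sequence. [folklore] -/
theorem fin_length_singleton_eq (l : List (DEdge d)) (b : Fin ([l] : LoopSeq d).length) :
    b = ⟨0, Nat.zero_lt_one⟩ := by
  refine Fin.ext ?_
  have h1 := b.isLt
  simp only [List.length_singleton] at h1
  show b.val = 0
  omega

/-- Positive splittings of `(l)`. [cite: Chatterjee2019LargeN, §2.2 (𝕊⁺)] -/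
theorem sum_posSplitAt_singleton (l : List (DEdge d)) (f : LoopSeq d → ℝ) :
    ∑ o : SameIdx ([l] : LoopSeq d), f (LoopSeq.posSplitAt [l] o) =
      ∑ q : {xy : Fin l.length × Fin l.length // xy.1 ≠ xy.2 ∧ l.get xy.2 = l.get xy.1},
        f (LoopSeq.prune [posSplit₁ l q.1.1 q.1.2, posSplit₂ l q.1.1 q.1.2]) := by
  rw [Fintype.sum_sigma, Fintype.sum_eq_single (⟨0, Nat.zero_lt_one⟩ : Fin ([l] : LoopSeq d).length)]
  · rfl
  · exact fun b hb => (hb (fin_length_singleton_eq l b)).elim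

/-- Negative splittings of `(l)`. [cite: Chatterjee2019LargeN, §2.2 (𝕊⁻)] -/
theorem sum_negSplitAt_singleton (l : List (DEdge d)) (f : LoopSeq d → ℝ) :
    ∑ o : InvIdx ([l] : LoopSeq d), f (LoopSeq.negSplitAt [l] o) =
      ∑ q : {xy : Fin l.length × Fin l.length // l.get xy.2 = DEdge.inv (l.get xy.1)},
        f (LoopSeq.prune [negSplit₁ l q.1.1 q.1.2, negSplit₂ l q.1.1 q.1.2]) := by
  rw [Fintype.sum_sigma, Fintype.sum_eq_single (⟨0, Nat.zero_lt_one⟩ : Fin ([l] : LoopSeq d).length)]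
  · rfl
  · exact fun b hb => (hb (fin_length_singleton_eq l b)).elim

/-- Negative twistings of `(l)`. [cite: Chatterjee2019LargeN, §2.2 (𝕋⁻)] -/
theorem sum_negTwistAt_singleton (l : List (DEdge d)) (f : LoopSeq d → ℝ) :
    ∑ o : SameIdx ([l] : LoopSeq d), f (LoopSeq.negTwistAt [l] o) =
      ∑ q : {xy : Fin l.length × Fin l.length // xy.1 ≠ xy.2 ∧ l.get xy.2 = l.get xy.1},
        f (LoopSeq.prune [negTwist l q.1.1 q.1.2]) := by
  rw [Fintype.sum_sigma, Fintype.sum_eq_single (⟨0, Nat.zero_lt_one⟩ : Fin ([l] : LoopSeq d).length)]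
  · rfl
  · exact fun b hb => (hb (fin_length_singleton_eq l b)).elim

/-- Positive twistings of `(l)`. [cite: Chatterjee2019LargeN, §2.2 (𝕋⁺)] -/
theorem sum_posTwistAt_singleton (l : List (DEdge d)) (f : LoopSeq d → ℝ) :
    ∑ o : InvIdx ([l] : LoopSeq d), f (LoopSeq.posTwistAt [l] o) =
      ∑ q : {xy : Fin l.length × Fin l.length // l.get xy.2 = DEdge.inv (l.get xy.1)},
        f (LoopSeq.prune [posTwist l q.1.1 q.1.2]) := by
  rw [Fintype.sum_sigma, Fintype.sum_eq_single (⟨0, Nat.zero_lt_one⟩ : Fin ([l] : LoopSeq d).length)]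
  · rfl
  · exact fun b hb => (hb (fin_length_singleton_eq l b)).elim

/-- Positive deformations of `(l)`. [cite: Chatterjee2019LargeN, §2.2 (𝔻⁺)] -/
theorem sum_posDeformAt_singleton (l : List (DEdge d)) (f : LoopSeq d → ℝ) :
    ∑ o : DeformIdx ([l] : LoopSeq d), f (LoopSeq.posDeformAt [l] o) =
      ∑ y : (Σ x : Fin l.length, ↥(plaquettesAt (l.get x))), f (LoopSeq.prune [posDeform l y.1 y.2.1]) := by
  rw [Fintype.sum_sigma, Fintype.sum_eq_single (⟨0, Nat.zero_lt_one⟩ : Fin ([l] : LoopSeq d).length)]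
  · rfl
  · exact fun b hb => (hb (fin_length_singleton_eq l b)).elim

/-- Negative deformations of `(l)`. [cite: Chatterjee2019LargeN, §2.2 (𝔻⁻)] -/
theorem sum_negDeformAt_singleton (l : List (DEdge d)) (f : LoopSeq d → ℝ) :
    ∑ o : DeformIdx ([l] : LoopSeq d), f (LoopSeq.negDeformAt [l] o) =
      ∑ y : (Σ x : Fin l.length, ↥(plaquettesAt (l.get x))), f (LoopSeq.prune [negDeform l y.1 y.2.1]) := by
  rw [Fintype.sum_sigma, Fintype.sum_eq_single (⟨0, Nat.zero_lt_one⟩ : Fin ([l] : LoopSeq d).length)]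
  · rfl
  · exact fun b hb => (hb (fin_length_singleton_eq l b)).elim

/-- `|s| = Σᵢ |lᵢ|` over the components. [cite: Chatterjee2019LargeN, §2.1] -/
theorem len_eq_sum_get (s : LoopSeq d) : (s.len : ℝ) = ∑ i : Fin s.length, ((s.get i).length : ℝ) :=
  (CoeffCatalanBoundProof.sum_length_get s).symm

/-- The splitting pieces of a genuine loop are non-null, so no pruning happens.
[cite: Chatterjee2019LargeN, Lemmas 9.3, 9.5 (the pieces are non-null)] -/
theorem prune_posSplit {l : List (DEdge d)} (hl : IsLoop l) {x y : Fin l.length} (hxy : x ≠ y) (he : l.get y = l.get x) :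
    LoopSeq.prune [posSplit₁ l x y, posSplit₂ l x y] = [posSplit₁ l x y, posSplit₂ l x y] :=
  LoopSeq.prune_eq_self fun w hw => by
    simp only [List.mem_cons, List.not_mem_nil, or_false] at hw
    rcases hw with rfl | rfl
    · exact Word.posSplit₁_ne_nil hl hxy he
    · exact Word.posSplit₂_ne_nil hl hxy he

/-- The negative splitting pieces of a genuine loop are non-null. [cite: Chatterjee2019LargeN, Lemma 9.5] -/
theorem prune_negSplit {l : List (DEdge d)} (hl : IsLoop l) {x y : Fin l.length} (he : l.get y = DEdge.inv (l.get x)) :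
    LoopSeq.prune [negSplit₁ l x y, negSplit₂ l x y] = [negSplit₁ l x y, negSplit₂ l x y] :=
  LoopSeq.prune_eq_self fun w hw => by
    simp only [List.mem_cons, List.not_mem_nil, or_false] at hw
    rcases hw with rfl | rfl
    · exact Word.negSplit₁_ne_nil hl he
    · exact Word.negSplit₂_ne_nil hl he

/-- Pruning a one-word list: `prune [w] = []` or `[w]`. [folklore] -/
theorem prune_singleton (w : List (DEdge d)) :
    LoopSeq.prune [w] = if w = [] then [] else [w] := by
  unfold LoopSeq.prune
  by_cases h : w = [] <;> simp [h]

end StringDuality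

end Summit.QuantumFields.GaugeBoot

end
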